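import Summits.ResolutionOfSingularities.ResolutionOfSingularities.Theorems.FrobeniusClosingPatchingRelPerfectDepthPhaseCCarrierGameLiftAmbient
import Literature.AlgebraicGeometry.Resolution.HypersurfaceRestriction
import HarnessLib

/-!
# Crux `PatchingRelPerfect` (stmt-ResolutionOfSingularities-16161), chain W5.2 — F7(β) (β-AX) X3 C-I (M2b-T) (T-c), piece 3:
# the TRACE IDENTITY at the end of the contact transport

[OURS · L1 W5.2 · F7(β) (β-AX) X3 C-I (M2b-T) (T-c) · res-D-pv-034 AS res-L1-s36-pv-3 per DESK WORD 20:05:57Z (G12-29/G12-32).]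
Replaces the role of NO printed item; NOT a statement of the manuscript under review; fact-free, def-free.  AI-written; AI review
is weaker than expert review.

tri-2 K16 (20:00:04Z/20:03:16Z): at the end of the transported F-60 sequence the residual ideal reads
`K_f = (e·v_f) + (e N′·φ̃_f) + (μ_f^{tot})` with `e, N′, μ` monomials in the boundary letters `𝓑`, `G = (v_f)` the carrier and
`Φ = (φ̃_f)` the strict transform of the X-hypersurface.  In ideal-sheaf form `K = G·𝓜(M₁) ⊔ Φ·𝓜(M₂) ⊔ 𝓜(M₃)` (`𝓜 = monomialIdeal`);
restricted to `V(G)` the first summand dies, and the rest IS the monomial sum `Σ 𝒦` on the letters `𝓑 ++ [Φ]` with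
`𝒦 = [M₂ ++ [(Φ,1)], M₃ ++ [(Φ,0)]]` — the `hJ`/`hbd`/`h𝒦` binders of `carrierGameLift_of_ambientLetters` (p563491).

* `comap_subschemeι_eq_monomialSum_of_end_formula`.
-/

-- `Summit.<Summit>.<Sub>.Theorems` with `Sub = Summit` (single-conjunct summit, D-0017)
set_option linter.dupNamespace false

noncomputable section

open CategoryTheory AlgebraicGeometry TopologicalSpace IsLocalRing
open Literature.AlgebraicGeometry.Resolution
open Scheme.IdealSheafData

namespace Summit.ResolutionOfSingularities.ResolutionOfSingularities.Theorems.DepthMultiHost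

open DepthTargets (monomialSum)

universe u

variable {X : Scheme.{u}}

/-- [OURS · L1 W5.2 · (T-c) piece 3] **THE TRACE IDENTITY from the END formula** `K = G·𝓜(M₁) ⊔ Φ·𝓜(M₂) ⊔ 𝓜(M₃)`:
`K|_{V(G)} = (Σ 𝒦)|_{V(G)}` for `𝒦 = [M₂ ++ [(Φ,1)], M₃ ++ [(Φ,0)]]`, every `A ∈ 𝒦` with `boundaryOf A = 𝓑 ++ [Φ]`, `𝒦 ≠ []`.
[cite: Kollar2007, (3.111) Step 3] -/
theorem comap_subschemeι_eq_monomialSum_of_end_formula (G Φ K : X.IdealSheafData) (M₁ M₂ M₃ : List (X.IdealSheafData × ℕ))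
    (𝓑 : List X.IdealSheafData) (hb₂ : boundaryOf M₂ = 𝓑) (hb₃ : boundaryOf M₃ = 𝓑)
    (hK : K = G * monomialIdeal M₁ ⊔ Φ * monomialIdeal M₂ ⊔ monomialIdeal M₃) :
    K.comap G.subschemeι = (monomialSum [M₂ ++ [(Φ, 1)], M₃ ++ [(Φ, 0)]]).comap G.subschemeι ∧
      (∀ A ∈ ([M₂ ++ [(Φ, 1)], M₃ ++ [(Φ, 0)]] : List (List (X.IdealSheafData × ℕ))), boundaryOf A = 𝓑 ++ [Φ]) ∧
      ([M₂ ++ [(Φ, 1)], M₃ ++ [(Φ, 0)]] : List (List (X.IdealSheafData × ℕ))) ≠ [] := by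
  have hG : G.comap G.subschemeι = ⊥ := by
    have h := comap_ker_self G.subschemeι
    rwa [G.ker_subschemeι] at h
  refine ⟨?_, ?_, List.cons_ne_nil _ _⟩
  · rw [hK]
    simp only [monomialSum, List.map_cons, List.map_nil, List.foldr_cons, List.foldr_nil, comap_sup, comap_mul, hG,
      bot_mul, bot_sup_eq, sup_bot_eq, monomialIdeal_append, monomialIdeal_singleton, pow_one, pow_zero, mul_one]
    rw [mul_comm (Φ.comap G.subschemeι)]
  · intro A hA
    simp only [List.mem_cons, List.not_mem_nil, or_false] at hA
    rcases hA with rfl | rfl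
    · rw [boundaryOf_append, hb₂]; rfl
    · rw [boundaryOf_append, hb₃]; rfl

end Summit.ResolutionOfSingularities.ResolutionOfSingularities.Theorems.DepthMultiHost

end
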